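import Mathlib.Analysis.Analytic.IteratedFDeriv
import Mathlib.Analysis.SpecificLimits.Basic
import Mathlib.Analysis.Complex.Basic
import Mathlib.Topology.Algebra.InfiniteSum.Real
import HarnessLib

/-!
# `UnitScaleTiltFluctuationComparisonRegPrTwoCutoffTowerLimit` — THE TOWER LIMIT: approximate fixed points of a fibrewise non-expanding pull-back converge to an EXACT coherent
# family; polynomial charts with prescribed symmetric flat kernels (crux `FluctuationComparisonRegPrIntL`, stmt-QuantumFields-20520, STUB 3⁗χ; cell `pub/ym-inputs`, INPUT-LIST I-11
# row p10 «K-uniform two-cut-off propagator estimate», seat ym-inputs-p10 g2, file 1 of 2; count-neutral helper, def-free)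

WHY.  3⁗χ's K1a row is recorded in TWO currencies: the two-run row `GlobalSlackKernelLeg.FlatKernelLegCauchyΦ` (run `K+1`'s transported flat kernels `kerT Φ K b Y d` against run
`K`'s `ker Φ K b Y d`) and the reference form — a HEIGHT-FREE family `Ψ` (`KerHeightFree Ψ`: `kerT Ψ = ker Ψ` exactly) with the per-run closeness rows `KernelRefΦ` / (R1)
`KernelRefOwnΦ` (`…GlobalSlackKernelLegRef(Own)`, ★w1-20520 g0).  The tree consumes the reference form in one direction only (`flatKernelLegCauchyΦ_of_ref`: reference ⟹ two-run);
every socket opens with `∃ Ψ, KerHeightFree Ψ ∧ …` and NO file constructs such a `Ψ` («`ψRef` has no def», memo `TWO-CUTOFF-PROPAGATOR-LOCATE-p10.md` §1).  The converse is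
[King1986]'s own mechanism (p.657 «{Z^{ε_K}} is a Cauchy sequence and converges to a unique limit»; Prop. 3.6 uniform in the number of extra slices): along the tower
`(K, b, Y) ↦ (K+1, b+1, refineSet Y)` the K1a budget `C·e^{−κ𝓛}·(L^{−(1+b)})^a` decays geometrically BY ITSELF (the chart index grows), so the transported kernels converge and
their limits form an exactly matched family.  This file is the Mathlib-level core of that construction (file 2, `…TwoCutoffKerHeightFree`, instantiates it at the tree's `ChartFam`):

* §1 **`exists_coherent_family`** — index set `ι` with a self-map `s`, complete normed fibres `V i`, pull-backs `θ i : V (s i) → V i` that are `1`-Lipschitz with `θ i 0 = 0`,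
  closed `θ`-stable sets `S i ∋ 0` (here: the symmetric multilinear maps); a family `M` with `‖θ i (M (s i)) − M i‖ ≤ ε i` on a FORWARD-CLOSED predicate `P`, budgets in
  ONE-STEP form `ε i + δ (s i) ≤ δ i`, `0 ≤ δ` on `P` ⟹ `∃ N, (∀ i, θ i (N (s i)) = N i) ∧ (∀ i, N i ∈ S i) ∧ (∀ i, P i → ‖M i − N i‖ ≤ δ i)` (`N i` = the limit of the
  pull-back iterates wherever the orbit meets `P`, `0` elsewhere; lemmas `norm_iterate_sub_iterate_le`, `norm_iterate_succ_sub_le`, `sum_range_iterate_le`,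
  `exists_tendsto_iterate`).  No iterated composition of dependent maps is ever formed: the iterates are those of ONE self-map of `Π i, V i`.
* §2 **`iteratedFDeriv_polyChart_eq`** — for a dependent family `N d` of continuous `d`-linear forms, symmetric for `d ∈ [2,7)`, the diagonal polynomial
  `x ↦ Σ_{d∈[2,7)} (d!)⁻¹·N_d(x,…,x)` has `D^d(·)(0) = N_d` (`d ∈ [2,7)`), `= 0` otherwise, value `0` and derivative `0` at `0`, and is entire
  (`HasFiniteFPowerSeriesOnBall.mk'`, `HasFPowerSeriesOnBall.iteratedFDeriv_eq_sum_of_completeSpace`, `|Perm (Fin d)| = d!`).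
* §3 four operator-norm trivia on `compContinuousLinearMap` with one map in every slot (closedness of the symmetric forms, subtraction, contraction, symmetry).

HONEST FRAMING.  Pure functional analysis over Mathlib; no lattice object and no estimate of [King1986] ∕ [Balaban1985UV3] is asserted or used (the `[cite]` tags locate the printed
mechanism).  Nothing here discharges the non-abelian K1a row (no carrier; E2 = NO); the stub, the crux and the (α) record are untouched; no summit or sub-problem statement is
proved; YM₃ on T³ is a ladder rung, not the Clay problem ∕ 𝕋⁴ ∕ a mass gap.

References: C. King, CMP 102 (1986) 649–677 [King1986] ((3.13) p.657; Prop. 3.6 (3.55)–(3.56) p.662, (3.58)–(3.61) p.663).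
-/

set_option autoImplicit false

noncomputable section

open Filter Topology
open scoped BigOperators Nat

namespace Summit.QuantumFields.YangMills.Theorems.TwoCutoffTowerLimit

/-! ## §1 Approximate fixed points of a fibrewise non-expanding pull-back converge to an exact coherent family -/

section Abstract

variable {ι : Type*} {V : ι → Type*} [∀ i, NormedAddCommGroup (V i)]

/-- **THE PULL-BACK ITERATES ARE NON-EXPANDING ALONG ORBITS**: for the fibrewise pull-back `step X i := θ i (X (s i))` of a family of `1`-Lipschitz maps,
`‖(step^[k] X) i − (step^[k] X′) i‖ ≤ ‖X (s^[k] i) − X′ (s^[k] i)‖`. [folklore] -/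
theorem norm_iterate_sub_iterate_le (s : ι → ι) (θ : ∀ i, V (s i) → V i) (hθ : ∀ i (x y : V (s i)), ‖θ i x - θ i y‖ ≤ ‖x - y‖)
    (X X' : ∀ i, V i) (k : ℕ) (i : ι) :
    ‖((fun (Z : ∀ j, V j) (j : ι) => θ j (Z (s j)))^[k] X) i - ((fun (Z : ∀ j, V j) (j : ι) => θ j (Z (s j)))^[k] X') i‖ ≤
      ‖X (s^[k] i) - X' (s^[k] i)‖ := by
  set step : (∀ j, V j) → (∀ j, V j) := fun Z j => θ j (Z (s j)) with hstep
  induction k generalizing i with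
  | zero => exact le_rfl
  | succ k ih =>
    rw [Function.iterate_succ_apply' step k X, Function.iterate_succ_apply' step k X']
    exact (hθ i _ _).trans (ih (s i))

/-- A forward-closed index predicate holds along the whole orbit. [folklore] -/
theorem iterate_mem_of_forward_closed (s : ι → ι) (P : ι → Prop) (hP : ∀ i, P i → P (s i)) (k : ℕ) (i : ι) (hi : P i) :
    P (s^[k] i) := by
  induction k generalizing i with
  | zero => exact hi
  | succ k ih => exact ih (s i) (hP i hi)

/-- **ONE-STEP INCREMENTS of the pull-back iterates of an approximate fixed point**: on the orbit of a point of the forward-closed predicate,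
`‖(step^[k+1] M) i − (step^[k] M) i‖ ≤ ε (s^[k] i)`. [folklore] -/
theorem norm_iterate_succ_sub_le (s : ι → ι) (θ : ∀ i, V (s i) → V i) (hθ : ∀ i (x y : V (s i)), ‖θ i x - θ i y‖ ≤ ‖x - y‖)
    (P : ι → Prop) (hP : ∀ i, P i → P (s i)) (M : ∀ i, V i) (ε : ι → ℝ) (hM : ∀ i, P i → ‖θ i (M (s i)) - M i‖ ≤ ε i)
    (k : ℕ) (i : ι) (hi : P i) :
    ‖((fun (Z : ∀ j, V j) (j : ι) => θ j (Z (s j)))^[k + 1] M) i - ((fun (Z : ∀ j, V j) (j : ι) => θ j (Z (s j)))^[k] M) i‖ ≤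
      ε (s^[k] i) := by
  have hk : P (s^[k] i) := iterate_mem_of_forward_closed s P hP k i hi
  rw [Function.iterate_succ_apply]
  exact (norm_iterate_sub_iterate_le s θ hθ _ M k i).trans (hM _ hk)

/-- **PARTIAL SUMS OF THE BUDGETS ALONG AN ORBIT** under the one-step recursion `ε i + δ (s i) ≤ δ i`: `Σ_{k<n} ε (s^[k] i) ≤ δ i − δ (s^[n] i)`. [folklore] -/
theorem sum_range_iterate_le (s : ι → ι) (P : ι → Prop) (hP : ∀ i, P i → P (s i)) (ε δ : ι → ℝ)
    (hδ : ∀ i, P i → ε i + δ (s i) ≤ δ i) (n : ℕ) (i : ι) (hi : P i) :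
    ∑ k ∈ Finset.range n, ε (s^[k] i) ≤ δ i - δ (s^[n] i) := by
  induction n generalizing i with
  | zero => simp
  | succ n ih =>
    rw [Finset.sum_range_succ']
    have h1 := ih (s i) (hP i hi)
    have h2 := hδ i hi
    simp only [Function.iterate_succ_apply, Function.iterate_zero_apply] at h1 ⊢
    linarith

/-- **CONVERGENCE OF THE PULL-BACK ITERATES on the orbit-closure of the predicate**: if some iterate `s^[k₀] i` satisfies `P`, the sequence `k ↦ (step^[k] M) i` converges
(complete fibres; increments summable along the tail of the orbit). [folklore] -/
theorem exists_tendsto_iterate [∀ i, CompleteSpace (V i)] (s : ι → ι) (θ : ∀ i, V (s i) → V i)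
    (hθ : ∀ i (x y : V (s i)), ‖θ i x - θ i y‖ ≤ ‖x - y‖)
    (P : ι → Prop) (hP : ∀ i, P i → P (s i)) (M : ∀ i, V i) (ε δ : ι → ℝ) (hM : ∀ i, P i → ‖θ i (M (s i)) - M i‖ ≤ ε i)
    (hδ : ∀ i, P i → ε i + δ (s i) ≤ δ i) (hδ0 : ∀ i, P i → 0 ≤ δ i) (i : ι) (k₀ : ℕ) (hk₀ : P (s^[k₀] i)) :
    ∃ a : V i, Tendsto (fun k => ((fun (Z : ∀ j, V j) (j : ι) => θ j (Z (s j)))^[k] M) i) atTop (𝓝 a) := by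
  set step : (∀ j, V j) → (∀ j, V j) := fun Z j => θ j (Z (s j)) with hstep
  set i₀ := s^[k₀] i with hi₀
  -- the tail budgets along the orbit of `i₀`
  set d : ℕ → ℝ := fun j => ε (s^[j] i₀) with hd
  have hd0 : ∀ j, 0 ≤ d j := fun j =>
    (norm_nonneg _).trans (norm_iterate_succ_sub_le s θ hθ P hP M ε hM j i₀ hk₀)
  have hdsum : ∀ n, ∑ j ∈ Finset.range n, d j ≤ δ i₀ := fun n =>
    (sum_range_iterate_le s P hP ε δ hδ n i₀ hk₀).trans
      (sub_le_self _ (hδ0 _ (iterate_mem_of_forward_closed s P hP n i₀ hk₀)))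
  have hds : Summable d := summable_of_sum_range_le hd0 hdsum
  -- the shifted sequence is Cauchy
  have hincr : ∀ j, dist ((step^[j + k₀] M) i) ((step^[(j + 1) + k₀] M) i) ≤ d j := by
    intro j
    rw [dist_eq_norm, ← norm_neg, neg_sub, show (j + 1) + k₀ = k₀ + (j + 1) by omega, show j + k₀ = k₀ + j by omega,
      Function.iterate_add_apply step k₀ (j + 1) M, Function.iterate_add_apply step k₀ j M]
    refine (norm_iterate_sub_iterate_le s θ hθ _ _ k₀ i).trans ?_
    exact norm_iterate_succ_sub_le s θ hθ P hP M ε hM j i₀ hk₀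
  have hCS : CauchySeq fun j => (step^[j + k₀] M) i := cauchySeq_of_dist_le_of_summable d hincr hds
  obtain ⟨a, ha⟩ := cauchySeq_tendsto_of_complete hCS
  exact ⟨a, (tendsto_add_atTop_iff_nat k₀).mp ha⟩

/-- **APPROXIMATE FIXED POINTS OF A FIBREWISE NON-EXPANDING PULL-BACK CONVERGE TO AN EXACT COHERENT FAMILY.**  Index set `ι` with a self-map `s`, complete normed
fibres `V i`, pull-backs `θ i : V (s i) → V i` that are `1`-Lipschitz with `θ i 0 = 0`, closed `θ`-stable sets `S i ∋ 0`; a family `M` with `M i ∈ S i` and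
`‖θ i (M (s i)) − M i‖ ≤ ε i` on a forward-closed predicate `P`, budgets obeying `ε i + δ (s i) ≤ δ i`, `0 ≤ δ i` on `P`.  THEN there is a family `N` with
`θ i (N (s i)) = N i` for EVERY index, `N i ∈ S i` for every index, and `‖M i − N i‖ ≤ δ i` on `P` (`N i` = the limit of the pull-back iterates `(step^[k] M) i`
wherever the orbit meets `P`, `0` elsewhere). The mechanism of [King1986] p.657 «{Z^{ε_K}} is a Cauchy sequence and converges» for kernel families indexed by
(order, run, chart index, domain). [folklore] -/
theorem exists_coherent_family [∀ i, CompleteSpace (V i)] (s : ι → ι) (θ : ∀ i, V (s i) → V i)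
    (hθ : ∀ i (x y : V (s i)), ‖θ i x - θ i y‖ ≤ ‖x - y‖) (hθ0 : ∀ i, θ i 0 = 0)
    (S : ∀ i, Set (V i)) (hSc : ∀ i, IsClosed (S i)) (hS0 : ∀ i, (0 : V i) ∈ S i) (hSθ : ∀ i (x : V (s i)), x ∈ S (s i) → θ i x ∈ S i)
    (P : ι → Prop) (hP : ∀ i, P i → P (s i)) (M : ∀ i, V i) (hMS : ∀ i, P i → M i ∈ S i)
    (ε δ : ι → ℝ) (hM : ∀ i, P i → ‖θ i (M (s i)) - M i‖ ≤ ε i) (hδ : ∀ i, P i → ε i + δ (s i) ≤ δ i) (hδ0 : ∀ i, P i → 0 ≤ δ i) :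
    ∃ N : ∀ i, V i, (∀ i, θ i (N (s i)) = N i) ∧ (∀ i, N i ∈ S i) ∧ (∀ i, P i → ‖M i - N i‖ ≤ δ i) := by
  classical
  set step : (∀ j, V j) → (∀ j, V j) := fun Z j => θ j (Z (s j)) with hstep
  -- the orbit-closure of `P`
  have conv : ∀ i, (∃ k₀, P (s^[k₀] i)) → ∃ a : V i, Tendsto (fun k => (step^[k] M) i) atTop (𝓝 a) :=
    fun i ⟨k₀, hk₀⟩ => exists_tendsto_iterate s θ hθ P hP M ε δ hM hδ hδ0 i k₀ hk₀
  let N : ∀ i, V i := fun i => if h : ∃ k₀, P (s^[k₀] i) then (conv i h).choose else 0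
  have hN : ∀ i (h : ∃ k₀, P (s^[k₀] i)), Tendsto (fun k => (step^[k] M) i) atTop (𝓝 (N i)) := by
    intro i h
    simp only [N, dif_pos h]
    exact (conv i h).choose_spec
  have hgood : ∀ i, (∃ k₀, P (s^[k₀] (s i))) ↔ ∃ k₀, P (s^[k₀] i) := by
    intro i
    constructor
    · rintro ⟨k₀, hk⟩
      exact ⟨k₀ + 1, by rwa [Function.iterate_succ_apply]⟩
    · rintro ⟨k₀, hk⟩
      cases k₀ with
      | zero => exact ⟨0, hP i hk⟩
      | succ k => exact ⟨k, by rwa [Function.iterate_succ_apply] at hk⟩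
  -- continuity of the pull-backs
  have hθc : ∀ i, Continuous (θ i) := fun i =>
    (LipschitzWith.of_dist_le_mul fun x y => by
      rw [dist_eq_norm, dist_eq_norm, NNReal.coe_one, one_mul]; exact hθ i x y).continuous
  -- iterates stay in `S` once the orbit is in `P`
  have hSiter : ∀ k i, P (s^[k] i) → (step^[k] M) i ∈ S i := by
    intro k
    induction k with
    | zero => intro i hi; exact hMS i hi
    | succ k ih =>
      intro i hi
      rw [Function.iterate_succ_apply']
      exact hSθ i _ (ih (s i) hi)
  refine ⟨N, fun i => ?_, fun i => ?_, fun i hi => ?_⟩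
  · -- coherence
    by_cases h : ∃ k₀, P (s^[k₀] i)
    · have h' : ∃ k₀, P (s^[k₀] (s i)) := (hgood i).mpr h
      have h1 : Tendsto (fun k => θ i ((step^[k] M) (s i))) atTop (𝓝 (θ i (N (s i)))) :=
        ((hθc i).tendsto _).comp (hN (s i) h')
      have h2 : Tendsto (fun k => (step^[k + 1] M) i) atTop (𝓝 (N i)) := (tendsto_add_atTop_iff_nat 1).mpr (hN i h)
      have h3 : (fun k => θ i ((step^[k] M) (s i))) = fun k => (step^[k + 1] M) i := by
        funext k
        rw [Function.iterate_succ_apply']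
      rw [h3] at h1
      exact tendsto_nhds_unique h1 h2
    · have h' : ¬ ∃ k₀, P (s^[k₀] (s i)) := fun h' => h ((hgood i).mp h')
      simp only [N, dif_neg h, dif_neg h']
      exact hθ0 i
  · -- membership in `S`
    by_cases h : ∃ k₀, P (s^[k₀] i)
    · obtain ⟨k₀, hk₀⟩ := h
      refine (hSc i).mem_of_tendsto (hN i ⟨k₀, hk₀⟩) ?_
      filter_upwards [eventually_ge_atTop k₀] with k hk
      have hPk : P (s^[k] i) := by
        obtain ⟨j, rfl⟩ := Nat.exists_eq_add_of_le hk
        rw [Nat.add_comm, Function.iterate_add_apply]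
        exact iterate_mem_of_forward_closed s P hP j _ hk₀
      exact hSiter k i hPk
    · simp only [N, dif_neg h]
      exact hS0 i
  · -- the bound on `P`
    have h0 : ∃ k₀, P (s^[k₀] i) := ⟨0, hi⟩
    set d : ℕ → ℝ := fun j => ε (s^[j] i) with hd
    have hd0 : ∀ j, 0 ≤ d j := fun j => (norm_nonneg _).trans (norm_iterate_succ_sub_le s θ hθ P hP M ε hM j i hi)
    have hdsum : ∀ n, ∑ j ∈ Finset.range n, d j ≤ δ i := fun n =>
      (sum_range_iterate_le s P hP ε δ hδ n i hi).trans (sub_le_self _ (hδ0 _ (iterate_mem_of_forward_closed s P hP n i hi)))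
    have hds : Summable d := summable_of_sum_range_le hd0 hdsum
    have hincr : ∀ j, dist ((step^[j] M) i) ((step^[j + 1] M) i) ≤ d j := by
      intro j
      rw [dist_eq_norm, ← norm_neg, neg_sub]
      exact norm_iterate_succ_sub_le s θ hθ P hP M ε hM j i hi
    have hb := dist_le_tsum_of_dist_le_of_tendsto₀ d hincr hds (hN i h0)
    rw [Function.iterate_zero, id_eq, dist_eq_norm] at hb
    exact hb.trans (Real.tsum_le_of_sum_range_le hd0 hdsum)

end Abstract

/-! ## §2 Polynomial charts with prescribed symmetric flat kernels of orders `2 … 6` -/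

section PolyChart

variable {E : Type*} [NormedAddCommGroup E] [NormedSpace ℂ E]

/-- **THE FINITE POWER SERIES OF THE DIAGONAL POLYNOMIAL** `x ↦ Σ_{n∈[2,7)} (n!)⁻¹·N_n(x,…,x)`: it has the finite formal power series `n ↦ (n!)⁻¹•N_n` (`n ∈ [2,7)`,
else `0`) at `0` on the whole space. [folklore] -/
theorem hasFiniteFPowerSeriesOnBall_polyChart (N : (n : ℕ) → ContinuousMultilinearMap ℂ (fun _ : Fin n => E) ℂ) :
    HasFiniteFPowerSeriesOnBall (fun x : E => ∑ n ∈ Finset.Ico 2 7, ((n ! : ℂ))⁻¹ * N n (fun _ => x))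
      (fun n => if n ∈ Finset.Ico 2 7 then ((n ! : ℂ))⁻¹ • N n else 0) 0 7 ⊤ := by
  refine HasFiniteFPowerSeriesOnBall.mk' (fun m hm => ?_) (by simp) (fun y _ => ?_)
  · have : m ∉ Finset.Ico 2 7 := by simp [Finset.mem_Ico]; omega
    simp only [this, if_false]
  · rw [zero_add]
    have hterm : ∀ i : ℕ, ((fun n => if n ∈ Finset.Ico 2 7 then ((n ! : ℂ))⁻¹ • N n else 0) i : ContinuousMultilinearMap ℂ (fun _ : Fin i => E) ℂ)
        (fun _ => y) = if i ∈ Finset.Ico 2 7 then ((i ! : ℂ))⁻¹ * N i (fun _ => y) else 0 := by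
      intro i
      simp only
      split_ifs with h
      · simp [smul_eq_mul]
      · simp
    simp only [hterm]
    rw [Finset.sum_ite_mem, show Finset.range 7 ∩ Finset.Ico 2 7 = Finset.Ico 2 7 by decide]

/-- **PRESCRIBED KERNELS**: if each `N_n` (`n ∈ [2,7)`) is symmetric, the `d`-th Fréchet derivative at `0` of the diagonal polynomial `x ↦ Σ_{n∈[2,7)} (n!)⁻¹·N_n(x,…,x)` IS
`N_d` for `d ∈ [2,7)` (Mathlib `HasFPowerSeriesOnBall.iteratedFDeriv_eq_sum_of_completeSpace`: `D^d f(0)(v) = Σ_σ p_d(v∘σ)`, and `|Perm(Fin d)| = d!`). [folklore] -/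
theorem iteratedFDeriv_polyChart_eq (N : (n : ℕ) → ContinuousMultilinearMap ℂ (fun _ : Fin n => E) ℂ)
    (hN : ∀ n ∈ Finset.Ico 2 7, ∀ (v : Fin n → E) (σ : Equiv.Perm (Fin n)), N n (fun i => v (σ i)) = N n v)
    {d : ℕ} (hd : d ∈ Finset.Ico 2 7) :
    iteratedFDeriv ℂ d (fun x : E => ∑ n ∈ Finset.Ico 2 7, ((n ! : ℂ))⁻¹ * N n (fun _ => x)) 0 = N d := by
  ext v
  rw [(hasFiniteFPowerSeriesOnBall_polyChart N).toHasFPowerSeriesOnBall.iteratedFDeriv_eq_sum_of_completeSpace v]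
  simp only [hd, if_true, smul_apply, smul_eq_mul]
  have hσ : ∀ σ : Equiv.Perm (Fin d), ((d ! : ℂ))⁻¹ * N d (fun i => v (σ i)) = ((d ! : ℂ))⁻¹ * N d v := fun σ => by
    rw [hN d hd v σ]
  rw [Finset.sum_congr rfl fun σ _ => hσ σ, Finset.sum_const, Finset.card_univ, Fintype.card_perm, Fintype.card_fin,
    nsmul_eq_mul]
  have hd0 : ((d ! : ℂ)) ≠ 0 := by exact_mod_cast Nat.factorial_ne_zero d
  field_simp

/-- Outside the orders `[2,7)` the flat kernels of the diagonal polynomial vanish (no hypothesis on the `N_n`). [folklore] -/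
theorem iteratedFDeriv_polyChart_eq_zero (N : (n : ℕ) → ContinuousMultilinearMap ℂ (fun _ : Fin n => E) ℂ)
    {d : ℕ} (hd : d ∉ Finset.Ico 2 7) :
    iteratedFDeriv ℂ d (fun x : E => ∑ n ∈ Finset.Ico 2 7, ((n ! : ℂ))⁻¹ * N n (fun _ => x)) 0 = 0 := by
  ext v
  rw [(hasFiniteFPowerSeriesOnBall_polyChart N).toHasFPowerSeriesOnBall.iteratedFDeriv_eq_sum_of_completeSpace v]
  simp [hd]

/-- The diagonal polynomial vanishes at `0` (every order is `≥ 2`). [folklore] -/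
theorem polyChart_zero (N : (n : ℕ) → ContinuousMultilinearMap ℂ (fun _ : Fin n => E) ℂ) :
    (fun x : E => ∑ n ∈ Finset.Ico 2 7, ((n ! : ℂ))⁻¹ * N n (fun _ => x)) 0 = 0 := by
  refine Finset.sum_eq_zero fun n hn => ?_
  have hn2 : 0 < n := by have := (Finset.mem_Ico.mp hn).1; omega
  rw [(N n).map_coord_zero ⟨0, hn2⟩ rfl, mul_zero]

/-- The diagonal polynomial has no linear term: its Fréchet derivative at `0` vanishes ((32)-shape, `Deriv1VanishΦ`). [folklore] -/
theorem fderiv_polyChart_zero (N : (n : ℕ) → ContinuousMultilinearMap ℂ (fun _ : Fin n => E) ℂ) :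
    fderiv ℂ (fun x : E => ∑ n ∈ Finset.Ico 2 7, ((n ! : ℂ))⁻¹ * N n (fun _ => x)) 0 = 0 := by
  rw [(hasFiniteFPowerSeriesOnBall_polyChart N).toHasFPowerSeriesOnBall.hasFPowerSeriesAt.fderiv_eq]
  simp

/-- The diagonal polynomial is entire. [folklore] -/
theorem differentiable_polyChart (N : (n : ℕ) → ContinuousMultilinearMap ℂ (fun _ : Fin n => E) ℂ) :
    Differentiable ℂ (fun x : E => ∑ n ∈ Finset.Ico 2 7, ((n ! : ℂ))⁻¹ * N n (fun _ => x)) := fun x =>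
  ((hasFiniteFPowerSeriesOnBall_polyChart N).toHasFPowerSeriesOnBall.analyticAt_of_mem (by simp)).differentiableAt

end PolyChart

/-! ## §3 Multilinear trivia: one linear map in every slot -/

section Multilinear

/-- The symmetric continuous multilinear maps form a closed set (pointwise closed conditions). [folklore] -/
theorem isClosed_setOf_symmetric (E : Type*) [NormedAddCommGroup E] [NormedSpace ℂ E] (d : ℕ) :
    IsClosed {X : ContinuousMultilinearMap ℂ (fun _ : Fin d => E) ℂ | ∀ (v : Fin d → E) (σ : Equiv.Perm (Fin d)), X (fun j => v (σ j)) = X v} := by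
  simp only [Set.setOf_forall]
  exact isClosed_iInter fun v => isClosed_iInter fun σ =>
    isClosed_eq (continuous_eval_const _) (continuous_eval_const _)

/-- Precomposition with one linear map in every slot commutes with subtraction. [folklore] -/
theorem sub_compContinuousLinearMap' {E E' : Type*} [NormedAddCommGroup E] [NormedSpace ℂ E] [NormedAddCommGroup E'] [NormedSpace ℂ E'] {d : ℕ}
    (X X' : ContinuousMultilinearMap ℂ (fun _ : Fin d => E') ℂ) (T : E →L[ℂ] E') :
    (X - X').compContinuousLinearMap (fun _ => T) = X.compContinuousLinearMap (fun _ => T) - X'.compContinuousLinearMap (fun _ => T) := by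
  ext v
  simp [ContinuousMultilinearMap.compContinuousLinearMap_apply]

/-- Precomposition with a contraction in every slot does not increase the operator norm. [folklore] -/
theorem norm_compContinuousLinearMap_le_of_norm_le_one {E E' : Type*} [NormedAddCommGroup E] [NormedSpace ℂ E] [NormedAddCommGroup E'] [NormedSpace ℂ E']
    {d : ℕ} (X : ContinuousMultilinearMap ℂ (fun _ : Fin d => E') ℂ) {T : E →L[ℂ] E'} (hT : ‖T‖ ≤ 1) :
    ‖X.compContinuousLinearMap (fun _ => T)‖ ≤ ‖X‖ := by
  refine (ContinuousMultilinearMap.norm_compContinuousLinearMap_le _ _).trans ?_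
  have hprod : ∏ _i : Fin d, ‖T‖ ≤ 1 := Finset.prod_le_one (fun _ _ => norm_nonneg _) fun _ _ => hT
  calc ‖X‖ * ∏ _i : Fin d, ‖T‖ ≤ ‖X‖ * 1 := mul_le_mul_of_nonneg_left hprod (norm_nonneg _)
    _ = ‖X‖ := mul_one _

/-- A kernel precomposed with the same linear map in every slot stays symmetric. [folklore] -/
theorem symmetric_compContinuousLinearMap {E E' : Type*} [NormedAddCommGroup E] [NormedSpace ℂ E] [NormedAddCommGroup E'] [NormedSpace ℂ E'] {d : ℕ}
    {X : ContinuousMultilinearMap ℂ (fun _ : Fin d => E') ℂ} (hX : ∀ (v : Fin d → E') (σ : Equiv.Perm (Fin d)), X (fun j => v (σ j)) = X v)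
    (T : E →L[ℂ] E') (v : Fin d → E) (σ : Equiv.Perm (Fin d)) :
    X.compContinuousLinearMap (fun _ => T) (fun j => v (σ j)) = X.compContinuousLinearMap (fun _ => T) v := by
  simp only [ContinuousMultilinearMap.compContinuousLinearMap_apply]
  exact hX (fun j => T (v j)) σ

end Multilinear

end Summit.QuantumFields.YangMills.Theorems.TwoCutoffTowerLimit

end
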